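/-
Copyright: the b2b-balaban cell (near-miss cell 7), T⁴-continuum fan-out; row NE7b ROUND-2 swarm, seat
t4-ne7b-formalise-leaf-05 gen 10 (row S12o «CONCAVE ENTROPY REPAIR» of `t4/b2b-balaban-t4-ne7b-p1/LEAVES-NE7b.md`, part
(ii) «THE WIRING», file 3∕4; owner's ruling R-OWNER-23-15 and division of labour, journal l.17861 ∕ l.17953 ∕ l.18163;
CLAIM l.17968).  Released under the licence of the surrounding project.
-/
import Summits.QuantumFields.BalabanUV.T4Continuum.Support.HistoryJoinsPlacedEndConcave
import Summits.QuantumFields.BalabanUV.T4Continuum.Support.HistoryJoinsPlacedOmegaSharp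
import Summits.QuantumFields.BalabanUV.T4Continuum.Support.HistoryJoinsPlacedLaws

/-!
# The count's CONCAVE END for the concrete zone `zoneP` (row S12o part (ii), file 3∕4 — B2′)

Summits-side support leaf of the T⁴-continuum cell (rung (B)+1 on a FINITE torus only; NOT infinite volume, NOT the
mass gap, NOT the Clay statement; NOT a proof of the spine estimate NE7b).  Row NE7b, route «COUNT»; smallness-census
rows S12n ∕ S12o.  SIBLING of gen 4's file B2 `HistoryJoinsPlacedLaws.card_S_le_exp_pow_zoneP` (§6): the SAME binders,
the SAME reading laws of the concrete zone consumed BY NAME (`hzoneW_zoneP`, `hlawM_zoneP`, `hlawC_zoneP`,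
`hlawT_zoneP'`, leaf-10 gen 4's template count `A_le_exp`, gen 3's `total_potential_le`), TWO suppliers changed:
the END is file 2∕4's concave kit END `HistoryJoinsPlacedEndConcave.card_S_le_exp_pow_kit'` (mass exponent
`1 + log κM`, part 7′ ∕ (i-b)), read at leaf-10 g12's SCALED nearness kit `nearPΩ` ∕ `radPΩ` ∕ `NZPΩ'` ∕ `MρPΩ'`
(`HistoryJoinsPlacedOmega`, row S12o (i-c)) with the radius-factor product bounded by their wiring-shaped corollary
`HistoryJoinsPlacedOmegaSharp.MρP_placedΩ_le_exp_split` (distance through ONE logarithm; template entropy `d₁·Cr` kept).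
[folklore] composition BY NAME; nothing is quoted from print, nothing printed is asserted, no `[cite:]` tag, no `Prop`
fact, no definition, constants symbolic (c2∕c6); no landed file is edited; no END of record ∕ exit ∕ socket ∕
`HistoryConstants*` file is touched (c3).

LETTERS (as file B2, leaf-04 gen 3's; symbolic): `A₁ = (2·cth c 1 s + 1)^d`, `A = A₁·5^d`, `C₁ = (2c+1)^d`, `Cr = 4·2^d`,
`WB = 2A₁·C₁·Cr`, `WM = 4A`, `γ′ = 2A`, `ρℓ = max 1 (2c+2)`, `X = (WB+WM)∕(1−θ)`, `d₁ = 2·log(2d+1)`; NEW: the scale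
**`Ω = ρℓ·X + ρℓ·γ′ + 1`** (leaf-10 g12's `K₁ + c₉ + 1` with `K₁ = ρℓ·X`, `c₉ = ρℓ·γ′`), pivot `ρ₀ = Ω·(1 + Cr)` (inside
`MρP_placedΩ_le_exp_split`).

WHAT.
* §1 **`hlawRΩ_of_laws`** — the scaled radius law from the two reading laws (gen 3's `hlawR_of_laws` for `radPΩ`):
  `cdist ≤ C₁·zmass + c₁` and `tsz (root template) ≤ κT·(fat root + 1)` give, for `Ω ≥ 0`,
  `radPΩ ≤ 1·(C₁·zmass + Ω·κT·(fat root + 1)) + c₁`.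
* §2 **`card_S_le_exp_pow_zonePΩ`** — THE CONCAVE END FOR THE CONCRETE ZONE: for every chronological structure
  `G : Gen PEv` dated strictly before `T ≤ K + 1`, every root datum `z` and every entropy input
  `ENT step G ≤ κE·F + μE·partnerAges + Ξ` (binders of B2's `card_S_le_exp_pow_zoneP` VERBATIM):
  `#S (zoneP …) ρ c₀ step G z ≤ exp((1 + log(X + 2γ′) + κρΩ + κE)·F + Ξ)·(L^d·e^{μE})^{partnerAges step G}` with
  **`κρΩ = 0 + 3d₁ + 2d + d₁·Cr + d·log(2Ω(1 + Cr) + 1)`** — against B2's `(2 + (X + 2γ′) + κρ + κE)` with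
  `κρ = 2(d₁ + (2d+d₁)ρℓγ′) + (2d+d₁)(ρℓX + Cr)` (LINEAR in `X`; census of record: `Θ_tree(13) ≈ 2.36·10²⁷` vs
  `≈ 9·10²` here, leaf-08 g11's `HistoryThetaConcaveNumerals` ∕ leaf-10 g12's l.18285 for the numerals — none in this
  file).

HONEST SCOPE.  Bookkeeping∕geometry over OUR carriers; displayed for the twin END (file 4∕4): `Dated`∕`Chrono` of the
sorted flat twin, `T ≤ K + 1`, the entropy input, the stride∕smallness∕decay side conditions, `1 ≤ L`, `1 ≤ n`,
`LevelFn K lv` — exactly B2's list; the identification of Bałaban's regions with the reading stays H3; the headline's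
Prop (p224237) is unchanged (only the hidden ∃-bound `g₁` moves, via leaf-08 g11's part (iii)).  NE7b NOT proved; spine
0∕9.  HONEST DEPENDENCY (cell): continuum YM on T⁴ ⇐ BetaPertH ∧ nine spine estimates (0/9 proved); BetaPertH ⇐ (D1) ∧
(D4) ∧ CAP+tail; G-an2-4 gates asym, D1 and NE2/3/4.  This file changes none of it.
-/

open Finset
open Literature.MathematicalPhysics.QuantumFieldTheory.Balaban1983to89
open Literature.MathematicalPhysics.QuantumFieldTheory.Balaban1983to89.B13ScaleTransfer (Pt)
open T4PersistenceDictionary T4PartnerMultiplicity T4BranchingRecordsGas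
open Summit.QuantumFields.BalabanUV.T4Continuum.PlacementSkeleton
open Summit.QuantumFields.BalabanUV.T4Continuum.ZoneTorus
open Summit.QuantumFields.BalabanUV.T4Continuum.ZoneSkeleton
open Summit.QuantumFields.BalabanUV.T4Continuum.HistoryZones
open Summit.QuantumFields.BalabanUV.T4Continuum.HistoryZoneMass
open Summit.QuantumFields.BalabanUV.T4Continuum.HistoryZoneEvolve
open Summit.QuantumFields.BalabanUV.T4Continuum.HistoryZoneEvolveLevels
open Summit.QuantumFields.BalabanUV.T4Continuum.HistoryZoneMassLaw
open Summit.QuantumFields.BalabanUV.T4Continuum.HistoryZoneMassJoins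
open Summit.QuantumFields.BalabanUV.T4Continuum.HistoryZoneMassTotal
open Summit.QuantumFields.BalabanUV.T4Continuum.HistoryZoneMassPieces
open Summit.QuantumFields.BalabanUV.T4Continuum.HistoryZoneMassCluster
open Summit.QuantumFields.BalabanUV.T4Continuum.HistoryZoneMassBridge
open Summit.QuantumFields.BalabanUV.T4Continuum.HistoryMassPlacement
open Summit.QuantumFields.BalabanUV.T4Continuum.HistoryJoins
open Summit.QuantumFields.BalabanUV.T4Continuum.HistoryJoinsAdm
open Summit.QuantumFields.BalabanUV.T4Continuum.HistoryJoinsBudget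
open Summit.QuantumFields.BalabanUV.T4Continuum.HistoryJoinsEntropyBudget
open Summit.QuantumFields.BalabanUV.T4Continuum.HistoryJoinsTag
open Summit.QuantumFields.BalabanUV.T4Continuum.HistoryJoinsSup
open Summit.QuantumFields.BalabanUV.T4Continuum.HistoryJoinsSupTorus
open Summit.QuantumFields.BalabanUV.T4Continuum.HistoryJoinsSupExtent
open Summit.QuantumFields.BalabanUV.T4Continuum.HistoryJoinsRadius
open Summit.QuantumFields.BalabanUV.T4Continuum.HistoryJoinsNonhost
open Summit.QuantumFields.BalabanUV.T4Continuum.HistoryRegionTemplates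
open Summit.QuantumFields.BalabanUV.T4Continuum.HistoryJoinsTemplates
open Summit.QuantumFields.BalabanUV.T4Continuum.HistoryJoinsPlacedZone
open Summit.QuantumFields.BalabanUV.T4Continuum.HistoryJoinsPlaced
open Summit.QuantumFields.BalabanUV.T4Continuum.HistoryJoinsPlacedEnd
open Summit.QuantumFields.BalabanUV.T4Continuum.HistoryJoinsPlacedEndConcave
open Summit.QuantumFields.BalabanUV.T4Continuum.HistoryJoinsPlacedOmega
open Summit.QuantumFields.BalabanUV.T4Continuum.HistoryJoinsPlacedOmegaSharp
open Summit.QuantumFields.BalabanUV.T4Continuum.HistoryJoinsPlacedTagged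
open Summit.QuantumFields.BalabanUV.T4Continuum.HistoryJoinsPlacedLaws

namespace Summit.QuantumFields.BalabanUV.T4Continuum.HistoryJoinsPlacedLawsConcave

noncomputable section

open scoped Classical

/-! ## §1 The scaled radius law from the two reading laws -/

section RadiusLaw

variable {ε R Tm : Type*} [LinearOrder R] [Fintype Tm] {d n L K D : ℕ} (sh : ε → PEv) (lv : ℕ → ℕ) (tsz : Tm → ℕ)
  (Ω : ℝ)
  (zone : ℕ → Gen ε → (Addr D → TCell d (n * L ^ K) × Tm) → Finset (Fin d → ℕ))
  (ρ : (Addr D → TCell d (n * L ^ K) × Tm) → R) (c₀ : TCell d (n * L ^ K) × Tm)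

/-- **THE SCALED RADIUS LAW FROM TWO READING LAWS** at the non-host parts (gen 3's `hlawR_of_laws` for leaf-10 g12's
`radPΩ`): a cyclic-distance law `cdist (u, root block) ≤ C₁·zmass + c₁` and a root-template law
`tsz (root template) ≤ κT·(fat root + 1)` give, for a scale `Ω ≥ 0`,
`radPΩ ≤ 1·(C₁·zmass + Ω·κT·(fat root + 1)) + c₁`. [folklore] -/
theorem hlawRΩ_of_laws (hΩ : 0 ≤ Ω) {G : Gen ε} {θ WB WM C₁ c₁ κT : ℝ}
    (hlawC : ∀ (X Y : Gen ε) (e : ε), Gen.merge X Y e ∈ joins (PEv.step ∘ sh) G →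
      ∀ i, i ≠ hostIdx (PEv.step ∘ sh) X Y e →
        ∀ p ∈ Sany zone ρ c₀ (PEv.step ∘ sh) (part (PEv.step ∘ sh) (Gen.merge X Y e) i).2,
          ∀ u ∈ zone (sh e).step (part (PEv.step ∘ sh) (Gen.merge X Y e) i).2 p,
            ((cdist (n * L ^ (K - lv (sh e).step)) u
                (blk L (lv (sh e).step) (evalA c₀ p (rootAddr (part (PEv.step ∘ sh) (Gen.merge X Y e) i).2)).1) : ℕ) : ℝ) ≤
              C₁ * zmass sh θ WB WM (sh e).step (part (PEv.step ∘ sh) (Gen.merge X Y e) i).2 + c₁)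
    (hlawT : ∀ (X Y : Gen ε) (e : ε), Gen.merge X Y e ∈ joins (PEv.step ∘ sh) G →
      ∀ i, i ≠ hostIdx (PEv.step ∘ sh) X Y e →
        ∀ p ∈ Sany zone ρ c₀ (PEv.step ∘ sh) (part (PEv.step ∘ sh) (Gen.merge X Y e) i).2,
          (zone (sh e).step (part (PEv.step ∘ sh) (Gen.merge X Y e) i).2 p).Nonempty →
            (tsz (evalA c₀ p (rootAddr (part (PEv.step ∘ sh) (Gen.merge X Y e) i).2)).2 : ℝ) ≤
              κT * ((((sh (part (PEv.step ∘ sh) (Gen.merge X Y e) i).2.root).fat : ℕ) : ℝ) + 1)) :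
    ∀ (X Y : Gen ε) (e : ε), Gen.merge X Y e ∈ joins (PEv.step ∘ sh) G →
      ∀ i, i ≠ hostIdx (PEv.step ∘ sh) X Y e →
        ∀ p ∈ Sany zone ρ c₀ (PEv.step ∘ sh) (part (PEv.step ∘ sh) (Gen.merge X Y e) i).2,
          ∀ u ∈ zone (sh e).step (part (PEv.step ∘ sh) (Gen.merge X Y e) i).2 p,
            radPΩ n L K lv tsz Ω u (sh e).step (evalA c₀ p (rootAddr (part (PEv.step ∘ sh) (Gen.merge X Y e) i).2))
                (part (PEv.step ∘ sh) (Gen.merge X Y e) i).2.rootStep ≤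
              1 * (C₁ * zmass sh θ WB WM (sh e).step (part (PEv.step ∘ sh) (Gen.merge X Y e) i).2 +
                Ω * κT * ((((sh (part (PEv.step ∘ sh) (Gen.merge X Y e) i).2.root).fat : ℕ) : ℝ) + 1)) + c₁ := by
  intro X Y e hX i hi p hp u hu
  have h1 := hlawC X Y e hX i hi p hp u hu
  have h2 := hlawT X Y e hX i hi p hp ⟨u, hu⟩
  have hT0 : (0 : ℝ) ≤ κT * ((((sh (part (PEv.step ∘ sh) (Gen.merge X Y e) i).2.root).fat : ℕ) : ℝ) + 1) :=
    le_trans (Nat.cast_nonneg _) h2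
  have hZ0 : (0 : ℝ) ≤ C₁ * zmass sh θ WB WM (sh e).step (part (PEv.step ∘ sh) (Gen.merge X Y e) i).2 + c₁ :=
    le_trans (Nat.cast_nonneg _) h1
  have h3 : Ω * ((tsz (evalA c₀ p (rootAddr (part (PEv.step ∘ sh) (Gen.merge X Y e) i).2)).2 : ℝ) - 1) ≤
      Ω * κT * ((((sh (part (PEv.step ∘ sh) (Gen.merge X Y e) i).2.root).fat : ℕ) : ℝ) + 1) := by
    rw [mul_assoc]
    exact mul_le_mul_of_nonneg_left (by linarith) hΩ
  have h4 : 0 ≤ Ω * κT * ((((sh (part (PEv.step ∘ sh) (Gen.merge X Y e) i).2.root).fat : ℕ) : ℝ) + 1) := by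
    rw [mul_assoc]; exact mul_nonneg hΩ hT0
  rw [radPΩ_apply]
  refine max_le ?_ ?_ <;> linarith

end RadiusLaw

/-! ## §2 The concave END for the concrete zone -/

section Laws

variable {d n L K D M : ℕ} {lv : ℕ → ℕ} {c : ℕ} {c₀ : TCell d (n * L ^ K) × Template d M}
  {R : Type*} [LinearOrder R] (ρ : (Addr D → TCell d (n * L ^ K) × Template d M) → R)
  {G : Gen PEv} {T : ℕ}

/-- **ROW S12o (ii) — THE COUNT's CONCAVE END FOR THE CONCRETE ZONE `zoneP`.**  For every chronological structure
`G : Gen PEv` dated strictly before `T ≤ K + 1`, every root datum `z` and every entropy input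
`ENT step G ≤ κE·F + μE·partnerAges + Ξ` (the binders of B2's `card_S_le_exp_pow_zoneP` VERBATIM):
`#S (zoneP …) ρ c₀ step G z ≤ exp((1 + log(X + 2γ′) + κρΩ + κE)·F + Ξ)·(L^d·e^{μE})^{partnerAges step G}`,
`κρΩ = 0 + 3d₁ + 2d + d₁·Cr + d·log(2Ω(1 + Cr) + 1)`, `Ω = ρℓ·X + ρℓ·γ′ + 1` (letters in the module docstring) — file
2∕4's kit END at leaf-10 g12's scaled kit with `MρP_placedΩ_le_exp_split`, every reading law DISCHARGED by B2's.
[folklore] -/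
theorem card_S_le_exp_pow_zonePΩ (hL : 1 ≤ L) (hn : 1 ≤ n) (hlv : LevelFn K lv) (hDt : Dated PEv.step true T G)
    (hT : T ≤ K + 1) (hCh : Chrono PEv.step G)
    {s m : ℕ} (hs : 1 ≤ s) (hm : ∀ u : ℕ, u + s ≤ K → lv u + m ≤ lv (u + s))
    (hsmall : (((2 * cth c 1 s + 1) ^ d : ℕ) : ℝ) * (5 : ℝ) ^ d * ((max 1 (2 * c + 2) : ℕ) : ℝ) ≤ (L : ℝ) ^ m / 2)
    {θ : ℝ} (hθ0 : 0 ≤ θ) (hθ1 : θ < 1) (hθs : 1 / 2 ≤ θ ^ s) {κE μE Ξ : ℝ}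
    (hENT : ENT PEv.step G ≤
      κE * bsum (fun b => ((b.fat : ℕ) : ℝ) + 1) G + μE * partnerAges PEv.step G + Ξ)
    (z : TCell d (n * L ^ K) × Template d M) :
    ((S (zoneP n L K lv c c₀) ρ c₀ PEv.step G z).card : ℝ) ≤
      Real.exp ((1 + Real.log
            ((2 * (((2 * cth c 1 s + 1) ^ d : ℕ) : ℝ) * ((((2 * c + 1) ^ d : ℕ) : ℝ) * (4 * 2 ^ d)) +
                  4 * ((((2 * cth c 1 s + 1) ^ d : ℕ) : ℝ) * (5 : ℝ) ^ d)) / (1 - θ) +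
              2 * (2 * ((((2 * cth c 1 s + 1) ^ d : ℕ) : ℝ) * (5 : ℝ) ^ d))) +
            (0 + 3 * (2 * Real.log (2 * d + 1)) + 2 * (d : ℝ) + 2 * Real.log (2 * d + 1) * (4 * 2 ^ d) +
              (d : ℝ) * Real.log (2 *
                ((((max 1 (2 * c + 2) : ℕ) : ℝ) *
                      ((2 * (((2 * cth c 1 s + 1) ^ d : ℕ) : ℝ) * ((((2 * c + 1) ^ d : ℕ) : ℝ) * (4 * 2 ^ d)) +
                          4 * ((((2 * cth c 1 s + 1) ^ d : ℕ) : ℝ) * (5 : ℝ) ^ d)) / (1 - θ)) +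
                    ((max 1 (2 * c + 2) : ℕ) : ℝ) * (2 * ((((2 * cth c 1 s + 1) ^ d : ℕ) : ℝ) * (5 : ℝ) ^ d)) + 1) *
                  (1 + 4 * 2 ^ d)) + 1)) +
            κE) * bsum (fun b => ((b.fat : ℕ) : ℝ) + 1) G + Ξ) *
        (((L : ℝ) ^ d) * Real.exp μE) ^ partnerAges PEv.step G := by
  -- the letters
  set A₁ : ℝ := (((2 * cth c 1 s + 1) ^ d : ℕ) : ℝ) with hA₁
  set C₁ : ℝ := (((2 * c + 1) ^ d : ℕ) : ℝ) with hC₁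
  set ρℓ : ℝ := ((max 1 (2 * c + 2) : ℕ) : ℝ) with hρℓ
  set X : ℝ := (2 * A₁ * (C₁ * (4 * 2 ^ d)) + 4 * (A₁ * (5 : ℝ) ^ d)) / (1 - θ) with hX
  set Ω : ℝ := ρℓ * X + ρℓ * (2 * (A₁ * (5 : ℝ) ^ d)) + 1 with hΩ
  have hρ0 : (0 : ℝ) ≤ ρℓ := Nat.cast_nonneg _
  have hd₁ : (0 : ℝ) ≤ 2 * Real.log (2 * d + 1) :=
    mul_nonneg (by norm_num) (Real.log_nonneg (by norm_cast; omega))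
  have hA₁1 : (1 : ℝ) ≤ A₁ := by
    rw [hA₁]; exact_mod_cast Nat.one_le_pow _ _ (by omega)
  have h5 : (1 : ℝ) ≤ (5 : ℝ) ^ d := one_le_pow₀ (by norm_num)
  have hγ1 : (1 : ℝ) / 2 ≤ 2 * (A₁ * (5 : ℝ) ^ d) := by nlinarith
  have h1θ : 0 < 1 - θ := by linarith
  have hX0 : 0 ≤ X := by rw [hX]; positivity
  have hK₁ : 0 ≤ ρℓ * X := mul_nonneg hρ0 hX0
  have hc₉ : 0 ≤ ρℓ * (2 * (A₁ * (5 : ℝ) ^ d)) := by positivity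
  have hΩ0 : 0 < Ω := by rw [hΩ]; positivity
  have hΩeq : Ω = ρℓ * X + ρℓ * (2 * (A₁ * (5 : ℝ) ^ d)) + 1 := rfl
  have hkit := card_S_le_exp_pow_kit' (id : PEv → PEv) (zoneP n L K lv c c₀) ρ c₀
    (nearPΩ n L K lv (fun T : Template d M => T.1.card) Ω) (radPΩ n L K lv (fun T : Template d M => T.1.card) Ω)
    (NZPΩ' d L lv Ω (A d M)) (MρPΩ' d Ω (A d M))
    (nearPΩ_mono n L K lv (fun T : Template d M => T.1.card) Ω)
    (fun t Z q u _ hu => by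
      obtain ⟨htK, hsc, hrange⟩ := hzoneW_zoneP t Z q u hu
      exact nearPΩ_of_scale n L K lv (fun T : Template d M => T.1.card) Ω htK hsc hrange)
    (fun u t s' r => card_nearPΩ_le n L K lv (fun T : Template d M => T.1.card) Ω hL hΩ0 (fun m => le_rfl) u t s' r)
    (by positivity) (fun r => MρPΩ'_nonneg (A d M) r) (fun r t s' => NZPΩ'_le hlv hL (A d M) r t s')
    hθ0 hθ1 (by positivity) (by positivity) (by positivity) (one_le_kappaM hθ1 (by positivity) (by positivity) hγ1)
    hDt hCh (hlawM_zoneP ρ hL hn hlv hDt hT hCh hs hm hsmall hθ0 hθ1.le hθs)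
    (MρP_placedΩ_le_exp_split (id : PEv → PEv) lv (fun T : Template d M => T.1.card) Ω (zoneP n L K lv c c₀) ρ c₀
      (a₁ := 0) (d₁ := 2 * Real.log (2 * d + 1)) (C₀ := 1) (c₉ := ρℓ * (2 * (A₁ * (5 : ℝ) ^ d))) (K₁ := ρℓ * X)
      (K₂ := 4 * 2 ^ d)
      le_rfl hd₁ (fun m => by rw [zero_add]; exact A_le_exp d M m) zero_le_one hc₉ hK₁ (by positivity) le_rfl hΩeq
      (fun t P => ρℓ *
          zmass (id : PEv → PEv) θ (2 * A₁ * (C₁ * (4 * 2 ^ d))) (4 * (A₁ * (5 : ℝ) ^ d)) t P +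
        Ω * (4 * 2 ^ d) * (((P.root.fat : ℕ) : ℝ) + 1))
      (fun t P => add_nonneg (mul_nonneg hρ0 (zmass_nonneg (sh := (id : PEv → PEv)) hθ0 (by positivity)
        (by positivity) t P)) (by positivity)) G
      (hlawRΩ_of_laws (id : PEv → PEv) lv (fun T : Template d M => T.1.card) Ω (zoneP n L K lv c c₀) ρ c₀ hΩ0.le
        (hlawC_zoneP ρ hL hn hlv hDt hT hCh hs hm hsmall hθ0 hθ1.le hθs) (hlawT_zoneP' ρ G))
      (total_potential_le (id : PEv → PEv) hθ0 hθ1 (by positivity) (by positivity) hρ0 (by positivity) hDt hCh))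
    hENT z
  exact hkit

end Laws

end

end Summit.QuantumFields.BalabanUV.T4Continuum.HistoryJoinsPlacedLawsConcave
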